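import Summits.NavierStokesRegularity.FunctionalMining.TopEigStrainMixHeat
import Literature.Analysis.FunctionSpaces.TorusLinearisedFormTruncation
import HarnessLib

/-!
# FunctionalMining / NoGo — the SHARP Poincaré row of the strain, `4π²·Z₂ ≤ D₂`, and the
# sharp heat rate `8π²/3` of the symmetrised core `Φ₂ + Ψ₂` (door D-K6 (c), `q = 2`)

HONEST FRAMING. Search for candidate a priori estimates; no regularity claim. Nothing about
Navier–Stokes is proved or asserted in this file: static functional inequalities on the flat unit
torus only. Cell `pub-nsfunc`, no-go seat (gen 37), kernel candidate K8; companion of the staged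
K7 `NoGo/TopBotEigHeatCoerciveTwo` (`TopEig.topBotEigHeatCoercivePos_two`, rate `2/81` through
the crude codomain-generic Poincaré constant `d³ = 27` of
`CodomainSobolev.integral_norm_sq_le_card_cube_mul`).

WHAT IS PROVED [ours; folklore inequalities]:
* `TopEig.four_pi_sq_mul_integral_norm_sq_le_dirichlet` — the SHARP Poincaré–Wirtinger
  inequality for smooth zero-mean maps `f : T^d → EuclideanSpace ℝ ι` into a Euclidean space of
  ANY finite index type: `4π² ∫‖f‖² ≤ ∫ ∑ₖ ‖∂ₖf‖²`. The tree's sharp inequality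
  `Torus.four_pi_sq_mul_integral_norm_sq_le_gradNormSq` (Literature,
  `TorusLinearisedFormTruncation`; Parseval) is typed for velocity fields
  `T^d → EuclideanSpace ℝ d` only; each coordinate `f_p` is transported into the slot `i₀` of
  such a field by the continuous linear map `slotCLM i₀ p : a ↦ a_p • e_{i₀}` (an isometry on the
  coordinate), the velocity-field inequality is applied coordinatewise and summed over `p`.
* `TopEig.four_pi_sq_mul_strainMoment_two_le` — for every smooth `v` on `T³`:
  **`4π² · Z₂(v) ≤ D₂(v)`**, `Z₂ = torusStrainMoment 2 = ∫|S|²`,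
  `D₂ = strainGradDissipation 2 = ∫∑ₖ∑ᵢⱼ(∂ₖSᵢⱼ)²` (the strain
  `S = strainFlat v ∈ EuclideanSpace ℝ (Fin 3 × Fin 3)` has zero mean). This replaces the
  constant `27` of K7's `strainMoment_two_le : Z₂ ≤ 27·D₂` by the sharp `1/(4π²)` (equality on a
  single Fourier shell `|k| = 1`).
* `TopEig.topBotEigMoment_two_heatCoercive_sharp_of`, `TopEig.topBotEigHeatCoercivePos_two_of` —
  RATE BOOKKEEPING for door D-K6 (c) at `q = 2`: GIVEN the two K7 facts `Φ₂ + Ψ₂ ≤ Z₂` and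
  `(2/3)·D₂ ≤ heatDissipation (Φ₂+Ψ₂)` (hypotheses here; in K7 they are `topBotEigMoment_two_le`
  and the dissipation identity `heatDissipation (Φ₂+Ψ₂) = (2/3)D₂ + (4/3)T_G` with `T_G ≥ 0`),
  the symmetrised core is heat-coercive with the rate **`8π²/3`**:
  `HeatCoercive (topBotEigMoment 2) (8π²/3)`, i.e. `C_λ^sym(2) ≥ 8π²/3` — one third of the
  single-shell ceiling `8π² = 2·4π²` (every core decays at exactly that rate on a single Fourier
  shell). Unconditional once K7 is in the tree (a one-line corollary, prove/dict lane).

PROVENANCE / STATUS. The no-go seat (gen 37) typed and farm-checked this file; STATUS: STAGED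
(`pub-nsfunc-nogo/NoGo/TopBotEigHeatCoerciveTwoSharp.STAGING.lean`), filing by a prove seat on the
lead's word. [ours; K1-Q6 (c), heat side, `q = 2`, constants]
FILING (prove seat g26, REQUEST #22): declarations byte-identical to the no-go seat's staged `TopBotEigHeatCoerciveTwoSharp.STAGING.lean` 3ba93ecd8d6b098c; this line is the only addition.
-/

noncomputable section

open MeasureTheory Set Filter Topology Finset
open scoped InnerProductSpace RealInnerProductSpace Real

namespace Summit.NavierStokesRegularity.FunctionalMining

open Literature.Analysis.FunctionSpaces Literature.Analysis.FunctionSpaces.Torus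

namespace TopEig

open StrainL4 StrainMoment

/-! ## 1. The slot embedding and the sharp Poincaré inequality for Euclidean-valued maps -/

section Codomain

variable {d : Type*} [Fintype d] [DecidableEq d] {ι : Type*} [Fintype ι]

/-- The slot embedding `a ↦ a_p • e_{i₀}` of the `p`-th coordinate of `EuclideanSpace ℝ ι` into the
`i₀`-th slot of a velocity-type vector `EuclideanSpace ℝ d`. [bookkeeping] -/
def slotCLM (i₀ : d) (p : ι) : EuclideanSpace ℝ ι →L[ℝ] EuclideanSpace ℝ d :=
  (EuclideanSpace.proj p : EuclideanSpace ℝ ι →L[ℝ] ℝ).smulRight (EuclideanSpace.single i₀ (1 : ℝ))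

omit [Fintype ι] in
/-- The slot embedding is an isometry on the coordinate: `‖a_p • e_{i₀}‖ = |a_p|`. [bookkeeping] -/
theorem norm_slotCLM_sq (i₀ : d) (p : ι) (a : EuclideanSpace ℝ ι) :
    ‖slotCLM i₀ p a‖ ^ 2 = a p ^ 2 := by
  rw [slotCLM, ContinuousLinearMap.smulRight_apply, norm_smul, PiLp.norm_single, norm_one, mul_one,
    Real.norm_eq_abs, sq_abs]
  rfl

/-- **Sharp Poincaré–Wirtinger for Euclidean-valued maps on `T^d`**: for a smooth zero-mean
`f : T^d → EuclideanSpace ℝ ι` (any finite `ι`), `4π² ∫‖f‖² ≤ ∫ ∑ₖ ‖∂ₖ f‖²`. From the tree's sharp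
inequality for velocity fields (`Torus.four_pi_sq_mul_integral_norm_sq_le_gradNormSq`, Parseval),
applied to each coordinate transported into the slot `i₀` and summed. [folklore] -/
theorem four_pi_sq_mul_integral_norm_sq_le_dirichlet (i₀ : d)
    {f : UnitAddTorus d → EuclideanSpace ℝ ι} (hf : IsSmooth f) (h0 : HasZeroMean f) :
    4 * π ^ 2 * ∫ x, ‖f x‖ ^ 2 ≤ ∫ x, ∑ k, ‖Torus.partialDeriv k f x‖ ^ 2 := by
  -- the transported coordinates `w_p = slotCLM i₀ p ∘ f`
  have hw : ∀ p, IsSmooth (slotCLM i₀ p ∘ f) := fun p => hf.comp_clm _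
  have hw0 : ∀ p, HasZeroMean (slotCLM i₀ p ∘ f) := fun p => by
    show ∫ x, (slotCLM i₀ p ∘ f) x = 0
    have h := (slotCLM i₀ p : EuclideanSpace ℝ ι →L[ℝ] EuclideanSpace ℝ d).integral_comp_comm
      hf.integrable
    simp only [Function.comp_apply]
    rw [h, show (∫ x, f x) = 0 from h0, map_zero]
  -- the velocity-field inequality, coordinate by coordinate
  have hP : ∀ p, 4 * π ^ 2 * ∫ x, f x p ^ 2 ≤ ∫ x, ∑ k, Torus.partialDeriv k f x p ^ 2 := by
    intro p
    have h := Torus.four_pi_sq_mul_integral_norm_sq_le_gradNormSq (hw p) (hw0 p)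
    have e1 : (∫ x, ‖(slotCLM i₀ p ∘ f) x‖ ^ 2) = ∫ x, f x p ^ 2 :=
      integral_congr_ae (ae_of_all _ fun x => by
        show ‖slotCLM i₀ p (f x)‖ ^ 2 = f x p ^ 2
        exact norm_slotCLM_sq i₀ p (f x))
    have e2 : gradNormSq (slotCLM i₀ p ∘ f) = ∫ x, ∑ k, Torus.partialDeriv k f x p ^ 2 := by
      unfold gradNormSq
      refine integral_congr_ae (ae_of_all _ fun x => ?_)
      show (∑ k, ‖Torus.partialDeriv k (slotCLM i₀ p ∘ f) x‖ ^ 2) = _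
      refine Finset.sum_congr rfl fun k _ => ?_
      rw [Torus.partialDeriv_clm_comp hf, norm_slotCLM_sq]
    rw [e1, e2] at h
    exact h
  -- continuity / integrability of the coordinate integrands
  have hc0 : ∀ p, Continuous fun x => f x p ^ 2 := fun p =>
    ((EuclideanSpace.proj p : EuclideanSpace ℝ ι →L[ℝ] ℝ).continuous.comp hf.continuous).pow 2
  have hc1 : ∀ p, Continuous fun x => ∑ k, Torus.partialDeriv k f x p ^ 2 := fun p =>
    continuous_finsetSum _ fun k _ =>
      ((EuclideanSpace.proj p : EuclideanSpace ℝ ι →L[ℝ] ℝ).continuous.comp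
        (hf.partialDeriv k).continuous).pow 2
  -- `‖f‖² = ∑_p f_p²` and `∑ₖ‖∂ₖf‖² = ∑_p ∑ₖ (∂ₖf)_p²`, integrated
  have e3 : (∫ x, ‖f x‖ ^ 2) = ∑ p, ∫ x, f x p ^ 2 := by
    rw [← integral_finsetSum _ fun p _ => (hc0 p).integrable_unitAddTorus]
    exact integral_congr_ae (ae_of_all _ fun x => EuclideanCoord.norm_sq_eq_sum_sq (f x))
  have e4 : (∫ x, ∑ k, ‖Torus.partialDeriv k f x‖ ^ 2) =
      ∑ p, ∫ x, ∑ k, Torus.partialDeriv k f x p ^ 2 := by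
    rw [← integral_finsetSum _ fun p _ => (hc1 p).integrable_unitAddTorus]
    refine integral_congr_ae (ae_of_all _ fun x => ?_)
    show (∑ k, ‖Torus.partialDeriv k f x‖ ^ 2) = ∑ p, ∑ k, Torus.partialDeriv k f x p ^ 2
    rw [Finset.sum_comm]
    exact Finset.sum_congr rfl fun k _ => EuclideanCoord.norm_sq_eq_sum_sq _
  rw [e3, e4, Finset.mul_sum]
  exact Finset.sum_le_sum fun p _ => hP p

end Codomain

/-! ## 2. The sharp Poincaré row of the strain on `T³` -/

variable {v : UnitAddTorus (Fin 3) → EuclideanSpace ℝ (Fin 3)}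

/-- **Sharp Poincaré for the strain on `T³`: `4π² · Z₂(v) ≤ D₂(v)`** for every smooth `v`
(`Z₂ = ∫|S|²`, `D₂ = strainGradDissipation 2 = ∫∑ₖ∑ᵢⱼ(∂ₖSᵢⱼ)²`; the strain has zero mean).
[folklore] -/
theorem four_pi_sq_mul_strainMoment_two_le (hv : Torus.IsSmooth v) :
    4 * π ^ 2 * torusStrainMoment 2 v ≤ strainGradDissipation 2 v := by
  have h := four_pi_sq_mul_integral_norm_sq_le_dirichlet (0 : Fin 3) (isSmooth_strainFlat hv)
    (hasZeroMean_strainFlat hv)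
  have e1 : torusStrainMoment 2 v = ∫ x, ‖strainFlat v x‖ ^ 2 := by
    unfold torusStrainMoment
    refine integral_congr_ae (ae_of_all _ fun x => ?_)
    show torusStrainSqAt v x ^ ((2 : ℝ) / 2) = ‖strainFlat v x‖ ^ 2
    rw [div_self two_ne_zero, Real.rpow_one, norm_strainFlat_sq]
  have e2 : (∫ x, ∑ k, ‖Torus.partialDeriv k (strainFlat v) x‖ ^ 2) =
      strainGradDissipation 2 v := by
    unfold strainGradDissipation
    refine integral_congr_ae (ae_of_all _ fun x => ?_)
    show (∑ k, ‖Torus.partialDeriv k (strainFlat v) x‖ ^ 2) = _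
    rw [sum_norm_partialDeriv_strainFlat_sq hv]
    simp only [show (2 : ℝ) / 2 - 1 = 0 by norm_num, Real.rpow_zero, one_mul]
  rw [e1, ← e2]
  exact h

/-! ## 3. Rate bookkeeping for door D-K6 (c) at `q = 2`: the sharp constant `8π²/3` -/

/-- **The sharp rate of the symmetrised core at `q = 2`.** If `Φ₂ + Ψ₂ ≤ Z₂` and
`(2/3)·D₂ ≤ heatDissipation (Φ₂ + Ψ₂)` on smooth divergence-free fields of `T³` (both proved in the
staged K7 `NoGo/TopBotEigHeatCoerciveTwo`: `topBotEigMoment_two_le`, and the dissipation identity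
`heatDissipation (Φ₂+Ψ₂) = (2/3)D₂ + (4/3)T_G` with `T_G ≥ 0`), then
`HeatCoercive (Φ₂ + Ψ₂) (8π²/3)`: `C_λ^sym(2) ≥ 8π²/3`, a third of the single-shell value `8π²`.
[ours, bookkeeping] -/
theorem topBotEigMoment_two_heatCoercive_sharp_of
    (hle : ∀ w : UnitAddTorus (Fin 3) → EuclideanSpace ℝ (Fin 3), Torus.IsSmooth w →
      Torus.IsDivFree w → topBotEigMoment (d := Fin 3) 2 w ≤ torusStrainMoment 2 w)
    (hT : ∀ w : UnitAddTorus (Fin 3) → EuclideanSpace ℝ (Fin 3), Torus.IsSmooth w →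
      Torus.IsDivFree w →
        2 / 3 * strainGradDissipation 2 w ≤ heatDissipation (topBotEigMoment (d := Fin 3) 2) w) :
    HeatCoercive (d := Fin 3) (topBotEigMoment 2) (8 * π ^ 2 / 3) := by
  intro _ w hw hdiv _
  have h1 := four_pi_sq_mul_strainMoment_two_le hw
  have h2 := hle w hw hdiv
  have h3 := hT w hw hdiv
  have hπ : 0 ≤ π ^ 2 := sq_nonneg _
  have h4 : π ^ 2 * topBotEigMoment (d := Fin 3) 2 w ≤ π ^ 2 * torusStrainMoment 2 w :=
    mul_le_mul_of_nonneg_left h2 hπ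
  linarith

/-- Hence, under the same two K7 facts, the node with the sharp witness:
`TopBotEigHeatCoercivePos 2` via the rate `8π²/3`. [ours, bookkeeping] -/
theorem topBotEigHeatCoercivePos_two_of
    (hle : ∀ w : UnitAddTorus (Fin 3) → EuclideanSpace ℝ (Fin 3), Torus.IsSmooth w →
      Torus.IsDivFree w → topBotEigMoment (d := Fin 3) 2 w ≤ torusStrainMoment 2 w)
    (hT : ∀ w : UnitAddTorus (Fin 3) → EuclideanSpace ℝ (Fin 3), Torus.IsSmooth w →
      Torus.IsDivFree w →
        2 / 3 * strainGradDissipation 2 w ≤ heatDissipation (topBotEigMoment (d := Fin 3) 2) w) :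
    TopBotEigHeatCoercivePos (d := Fin 3) 2 :=
  ⟨8 * π ^ 2 / 3, by positivity, topBotEigMoment_two_heatCoercive_sharp_of hle hT⟩

end TopEig

end Summit.NavierStokesRegularity.FunctionalMining

end
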